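import Summits.QuantumFields.BalabanUV.Beta.GAN24.ScalarFreeResolvent

/-!
# Row G-an2-4 ∕ (CONV-C), scalar currency — THE DIAGONAL (ENTRY) BOUND FOR THE POWERS OF THE FREE RESOLVENT OF THE SCALAR
# FINE-TORUS LAPLACIAN: `|F^k(x, x′)| ≤ 3^{d+1}·n^{−(d+1)}` for `k ≥ d+1`, `F = (Δ + 1)⁻¹`, uniformly in the torus

NOT IN PRINT; OUR BOOKKEEPING.  Cell `pub-balaban`, G-an2-4 crux team (coordinator ruling e34b3e0c (2)), seat
`b2b-balaban-gan24-formalise-leaf-01` (gen 55), item «(s0) ∕ (K₀ˢ)» (`CLAIMS.log` l.28883 ∕ l.28893 ∕ l.28904 ∕ l.28990), module 3 of the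
line: the ONE genuinely spectral input of the route — the remainder `F^N G′` of the expansion `G′ = P_N − a′P_NΠ′G′ + F^N G′`
(`ScalarFreeResolvent.Gps_eq_resolvent_expansion`) is controlled in `ℓ^∞` through `Σ_{x′} F^N(x,x′)² w(x′) ≤ (max_{x′} F^N(x,x′))·(F^N w)(x)`,
and the entry maximum carries the dimensional factor `n^{−(d+1)}` that the `ℓ² → ℓ^∞` passage of `G′` costs.

WHAT IS PROVED (kernel; any `d`, any `n ≥ 1`, any torus `M : Fin (d+1) → ℕ`; Fourier bookkeeping of `B5LaplaceInverse` ∕ module 1 BY NAME):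
 * §1 (real analysis) `sum_inv_sq_add_sq_le`: `Σ_{m=1}^{K} (m² + A²)⁻¹ ≤ 2/A` (telescoping, no integrals);
 * §2 (one coordinate, `N₁ = n·M₁` sites) `norm_char_sub_one_sq_ge` (Jordan: `|ψ_{N₁}(j) − 1|² ≥ 16 v²/N₁²`, `v = valMinAbs j`),
   `card_filter_natAbs_valMinAbs_le_two`, **`oneDim_sum_le`**: `Σ_{j : ZMod N₁} (n²|ψ(j) − 1|² + 1)⁻¹ ≤ 2 + M₁`;
 * §3 `re_lsym_eq_sum` (`Re Δ(p) = Σ_ν n²|ψ(p_ν) − 1|²`), `norm_inv_lsym_add_one_pow_le_prod` (`|(Δ(p)+1)^{−k}| ≤ Π_ν (n²|ψ(p_ν)−1|² + 1)⁻¹`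
   for `k ≥ d+1` — each factor is `≤ Δ(p) + 1`, no AM–GM), `card_Tor_fine`, and the HEADLINE **`norm_inv_pow_apply_le`**:
   `‖((Δ + 1)⁻¹)^k (x, x′)‖ ≤ 3^{d+1}·(n^{d+1})⁻¹` for every `k ≥ d + 1`, every `x, x′`, every torus.

HONEST SCOPE.  [folklore] lattice Fourier analysis of the cell's typed `U = 1` objects; constants OURS and crude (`3^{d+1}`); nothing printed
by Bałaban is used or asserted.  No `def`, no `def … : Prop`, no `sorry`.  NOT (CONV-C), NEVER «G-an2-4 closed», NOT NE2 ∕ NE3, NOT D1, NOT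
BetaPertH, NOT the continuum limit, NOT Clay.  HONEST DEPENDENCY: continuum YM on T⁴ ⇐ BetaPertH ∧ nine spine estimates (0/9 proved); BetaPertH
⇐ (D1) ∧ (D4) ∧ CAP+tail; G-an2-4 gates asym, D1 and NE2/3/4.
-/

noncomputable section

open scoped BigOperators ComplexConjugate Matrix Real
open Finset Complex Matrix

namespace Summit.QuantumFields.BalabanUV.Beta.GAN24.ScalarFreeResolventDiagonal

open Literature.MathematicalPhysics.QuantumFieldTheory.Balaban1983to89
open B5Prop11Plancherel (Tor fine unitVec chi dft)
open B5Action121 (LapS)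
open B5LaplaceInverse (ssym lsym)
open B5G183KernelDecay (norm_exp_mul_I_sub_one_sq)
open Summit.QuantumFields.BalabanUV.Beta.GAN24.ScalarFreeResolvent

variable {d : ℕ}

/-! ## §1 A telescoping sum -/

/-- `Σ_{m=1}^{K} 1/(m² + A²) ≤ 2/A` for `A > 0` (each term is `≤ 2/((m−1+A)(m+A)) = 2/(m−1+A) − 2/(m+A)`). [folklore] -/
theorem sum_inv_sq_add_sq_le {A : ℝ} (hA : 0 < A) (K : ℕ) :
    ∑ m ∈ Finset.range K, (((m : ℝ) + 1) ^ 2 + A ^ 2)⁻¹ ≤ 2 / A := by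
  suffices h : ∑ m ∈ Finset.range K, (((m : ℝ) + 1) ^ 2 + A ^ 2)⁻¹ ≤ 2 / A - 2 / (K + A) by
    have : 0 < 2 / ((K : ℝ) + A) := by positivity
    linarith
  induction K with
  | zero => simp
  | succ K ih =>
      rw [Finset.sum_range_succ]
      have hKA : 0 < (K : ℝ) + A := by positivity
      have hKA1 : 0 < (K : ℝ) + 1 + A := by positivity
      have key : (((K : ℝ) + 1) ^ 2 + A ^ 2)⁻¹ ≤ 2 / ((K : ℝ) + A) - 2 / ((K : ℝ) + 1 + A) := by
        rw [div_sub_div _ _ hKA.ne' hKA1.ne', inv_eq_one_div, div_le_div_iff₀ (by positivity) (by positivity)]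
        nlinarith [sq_nonneg ((K : ℝ) + 1 - A)]
      push_cast
      linarith

/-! ## §2 One coordinate: the symbol of the 1-D second difference and its reciprocal sum -/

section OneDim

variable (N₁ : ℕ) [NeZero N₁]

/-- JORDAN'S INEQUALITY FOR THE CHARACTER: `|ψ_{N₁}(j) − 1|² ≥ 16 v²/N₁²`, `v = valMinAbs j` (`ψ(j) = e^{2πiv/N₁}`, `|2πv/N₁| ≤ π`,
`2 − 2cos θ = 4 sin²(θ/2) ≥ 4θ²/π²`). [folklore] -/
theorem norm_char_sub_one_sq_ge (j : ZMod N₁) :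
    16 * ((j.valMinAbs : ℝ)) ^ 2 / (N₁ : ℝ) ^ 2 ≤ ‖((ZMod.stdAddChar (N := N₁)) j : ℂ) - 1‖ ^ 2 := by
  have hN : (0 : ℝ) < N₁ := by exact_mod_cast Nat.pos_of_ne_zero (NeZero.ne N₁)
  set v : ℝ := (j.valMinAbs : ℝ) with hv
  set θ : ℝ := 2 * Real.pi * v / N₁ with hθ
  -- the character value
  have hψ : ((ZMod.stdAddChar (N := N₁)) j : ℂ) = Complex.exp ((θ : ℂ) * I) := by
    conv_lhs => rw [← ZMod.coe_valMinAbs j]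
    rw [ZMod.stdAddChar_coe]
    congr 1
    have hN' : ((N₁ : ℕ) : ℂ) ≠ 0 := by exact_mod_cast NeZero.ne N₁
    rw [hθ, hv]
    push_cast
    field_simp
  -- `|θ| ≤ π`
  have hvabs : |v| ≤ (N₁ : ℝ) / 2 := by
    have h := ZMod.natAbs_valMinAbs_le j
    have h1 : ((j.valMinAbs.natAbs : ℕ) : ℝ) ≤ (N₁ : ℝ) / 2 := by
      have h2 : ((j.valMinAbs.natAbs : ℕ) : ℝ) ≤ ((N₁ / 2 : ℕ) : ℝ) := by exact_mod_cast h
      refine h2.trans ?_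
      rw [le_div_iff₀ (by norm_num : (0:ℝ) < 2)]
      exact_mod_cast Nat.div_mul_le_self N₁ 2
    have e : |v| = ((j.valMinAbs.natAbs : ℕ) : ℝ) := by rw [Nat.cast_natAbs, Int.cast_abs, hv]
    rw [e]; exact h1
  have hθabs : |θ| ≤ Real.pi := by
    rw [hθ, abs_div, abs_of_pos hN, div_le_iff₀ hN, abs_mul, abs_of_pos (by positivity : (0:ℝ) < 2 * Real.pi)]
    nlinarith [Real.pi_pos]
  -- `2 − 2cos θ = 4 sin²(θ/2) ≥ 4 θ²/π²`
  rw [hψ, norm_exp_mul_I_sub_one_sq]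
  have hsin : 2 - 2 * Real.cos θ = 4 * Real.sin (θ / 2) ^ 2 := by
    rw [Real.sin_sq_eq_half_sub, show 2 * (θ / 2) = θ by ring]
    ring
  have hjordan : |θ| / Real.pi ≤ |Real.sin (θ / 2)| := by
    have h0 : 0 ≤ |θ| / 2 := by positivity
    have h1 : |θ| / 2 ≤ Real.pi / 2 := by linarith
    have h2 := Real.mul_le_sin h0 h1
    have habs : |θ / 2| = |θ| / 2 := by rw [abs_div, abs_two]
    rw [Real.abs_sin_eq_sin_abs_of_abs_le_pi (by rw [habs]; linarith [Real.pi_pos]), habs]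
    calc |θ| / Real.pi = 2 / Real.pi * (|θ| / 2) := by ring
      _ ≤ Real.sin (|θ| / 2) := h2
  have hsq : (|θ| / Real.pi) ^ 2 ≤ Real.sin (θ / 2) ^ 2 := by
    rw [← sq_abs (Real.sin (θ / 2))]
    exact pow_le_pow_left₀ (by positivity) hjordan 2
  rw [hsin]
  have e : 16 * v ^ 2 / (N₁ : ℝ) ^ 2 = 4 * (|θ| / Real.pi) ^ 2 := by
    rw [div_pow, sq_abs, hθ]
    field_simp
    ring
  rw [e]
  linarith

/-- the fibre of `j ↦ |valMinAbs j|` over any `m` has at most two elements (`j = ±m`). [folklore] -/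
theorem card_filter_natAbs_valMinAbs_le_two (m : ℕ) :
    (Finset.univ.filter fun j : ZMod N₁ => j.valMinAbs.natAbs = m).card ≤ 2 := by
  classical
  have hsub : (Finset.univ.filter fun j : ZMod N₁ => j.valMinAbs.natAbs = m) ⊆ {((m : ℤ) : ZMod N₁), ((-(m : ℤ) : ℤ) : ZMod N₁)} := by
    intro j hj
    rw [Finset.mem_filter] at hj
    rw [Finset.mem_insert, Finset.mem_singleton]
    rcases Int.natAbs_eq j.valMinAbs with h | h
    · left; rw [← ZMod.coe_valMinAbs j, h, hj.2]
    · right; rw [← ZMod.coe_valMinAbs j, h, hj.2]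
  exact (Finset.card_le_card hsub).trans Finset.card_le_two

/-- **THE ONE-COORDINATE RECIPROCAL SUM**: for `N₁ = n·M₁` sites, `Σ_{j : ZMod N₁} (n²·|ψ(j) − 1|² + 1)⁻¹ ≤ 2 + M₁`
(`n²|ψ(j)−1|² ≥ 16 v²/M₁²`; the fibres of `|v|` have `≤ 2` points; `Σ_{m≥1}(16m²/M₁² + 1)⁻¹ ≤ M₁/2` by §1). [folklore] -/
theorem oneDim_sum_le (n M₁ : ℕ) [NeZero n] [NeZero M₁] [NeZero (n * M₁)] :
    ∑ j : ZMod (n * M₁), ((n : ℝ) ^ 2 * ‖((ZMod.stdAddChar (N := n * M₁)) j : ℂ) - 1‖ ^ 2 + 1)⁻¹ ≤ 2 + (M₁ : ℝ) := by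
  classical
  have hn : (0 : ℝ) < n := by exact_mod_cast Nat.pos_of_ne_zero (NeZero.ne n)
  have hM : (0 : ℝ) < M₁ := by exact_mod_cast Nat.pos_of_ne_zero (NeZero.ne M₁)
  set g : ℕ → ℝ := fun m => (16 * (m : ℝ) ^ 2 / (M₁ : ℝ) ^ 2 + 1)⁻¹ with hg
  have hg0 : ∀ m, 0 ≤ g m := fun m => by rw [hg]; positivity
  have hg1 : ∀ m, g m ≤ 1 := fun m => by
    rw [hg]
    exact inv_le_one_of_one_le₀ (by linarith [(by positivity : (0 : ℝ) ≤ 16 * (m : ℝ) ^ 2 / (M₁ : ℝ) ^ 2)])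
  -- (1) termwise: `(n²|ψ−1|² + 1)⁻¹ ≤ g |v_j|`
  have hterm : ∀ j : ZMod (n * M₁), ((n : ℝ) ^ 2 * ‖((ZMod.stdAddChar (N := n * M₁)) j : ℂ) - 1‖ ^ 2 + 1)⁻¹ ≤ g j.valMinAbs.natAbs := by
    intro j
    have hj := norm_char_sub_one_sq_ge (n * M₁) j
    have e : (n : ℝ) ^ 2 * (16 * ((j.valMinAbs : ℝ)) ^ 2 / ((n * M₁ : ℕ) : ℝ) ^ 2) = 16 * ((j.valMinAbs.natAbs : ℕ) : ℝ) ^ 2 / (M₁ : ℝ) ^ 2 := by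
      have habs : ((j.valMinAbs.natAbs : ℕ) : ℝ) ^ 2 = ((j.valMinAbs : ℝ)) ^ 2 := by
        rw [Nat.cast_natAbs, Int.cast_abs, sq_abs]
      rw [habs]; push_cast; field_simp
    rw [hg]
    refine inv_anti₀ (by positivity) ?_
    rw [← e]
    nlinarith [hj, sq_nonneg (n : ℝ)]
  -- (2) regroup by the value of `|v_j|` (fibres of size ≤ 2, values ≤ N₁/2)
  set K := (n * M₁) / 2 with hK
  have hfib := Finset.sum_comp g (fun j : ZMod (n * M₁) => j.valMinAbs.natAbs) (s := Finset.univ)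
  have himg : Finset.univ.image (fun j : ZMod (n * M₁) => j.valMinAbs.natAbs) ⊆ Finset.range (K + 1) := by
    intro m hm
    rw [Finset.mem_image] at hm
    obtain ⟨j, -, rfl⟩ := hm
    rw [Finset.mem_range]
    exact Nat.lt_succ_of_le (ZMod.natAbs_valMinAbs_le j)
  have step2 : ∑ j : ZMod (n * M₁), g j.valMinAbs.natAbs ≤ ∑ m ∈ Finset.range (K + 1), 2 * g m := by
    rw [hfib]
    calc ∑ b ∈ Finset.univ.image (fun j : ZMod (n * M₁) => j.valMinAbs.natAbs),
          (Finset.univ.filter fun a : ZMod (n * M₁) => a.valMinAbs.natAbs = b).card • g b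
        ≤ ∑ b ∈ Finset.univ.image (fun j : ZMod (n * M₁) => j.valMinAbs.natAbs), 2 * g b := by
          refine Finset.sum_le_sum fun b _ => ?_
          rw [nsmul_eq_mul]
          exact mul_le_mul_of_nonneg_right (by exact_mod_cast card_filter_natAbs_valMinAbs_le_two (n * M₁) b) (hg0 b)
      _ ≤ ∑ m ∈ Finset.range (K + 1), 2 * g m :=
          Finset.sum_le_sum_of_subset_of_nonneg himg fun m _ _ => by linarith [hg0 m]
  -- (3) `Σ_{m ≤ K} g(m) ≤ 1 + M₁/2`
  have step3 : ∑ m ∈ Finset.range (K + 1), g m ≤ 1 + M₁ / 2 := by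
    rw [Finset.sum_range_succ']
    have hA : (0 : ℝ) < (M₁ : ℝ) / 4 := by positivity
    have htel := sum_inv_sq_add_sq_le hA K
    have e : ∀ m : ℕ, g (m + 1) = ((M₁ : ℝ) ^ 2 / 16) * (((m : ℝ) + 1) ^ 2 + ((M₁ : ℝ) / 4) ^ 2)⁻¹ := by
      intro m
      rw [hg]
      push_cast
      field_simp
      ring
    rw [Finset.sum_congr rfl fun m _ => e m, ← Finset.mul_sum]
    have h1 : (M₁ : ℝ) ^ 2 / 16 * ∑ i ∈ Finset.range K, (((i : ℝ) + 1) ^ 2 + ((M₁ : ℝ) / 4) ^ 2)⁻¹ ≤ M₁ / 2 := by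
      calc (M₁ : ℝ) ^ 2 / 16 * ∑ i ∈ Finset.range K, (((i : ℝ) + 1) ^ 2 + ((M₁ : ℝ) / 4) ^ 2)⁻¹
          ≤ (M₁ : ℝ) ^ 2 / 16 * (2 / ((M₁ : ℝ) / 4)) := mul_le_mul_of_nonneg_left htel (by positivity)
        _ = M₁ / 2 := by field_simp; ring
    have h0 : g 0 ≤ 1 := hg1 0
    linarith
  calc ∑ j : ZMod (n * M₁), ((n : ℝ) ^ 2 * ‖((ZMod.stdAddChar (N := n * M₁)) j : ℂ) - 1‖ ^ 2 + 1)⁻¹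
      ≤ ∑ j : ZMod (n * M₁), g j.valMinAbs.natAbs := Finset.sum_le_sum fun j _ => hterm j
    _ ≤ ∑ m ∈ Finset.range (K + 1), 2 * g m := step2
    _ = 2 * ∑ m ∈ Finset.range (K + 1), g m := by rw [Finset.mul_sum]
    _ ≤ 2 * (1 + M₁ / 2) := by linarith [step3]
    _ = 2 + (M₁ : ℝ) := by ring

end OneDim

/-! ## §3 The entry bound for `F^k`, `k ≥ d + 1` -/

section Diagonal

variable (n : ℕ) [NeZero n] (M : Fin (d + 1) → ℕ) [hM : ∀ μ, NeZero (M μ)]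

/-- `Re Δ(p) = Σ_ν n²·|ψ_{nM_ν}(p_ν) − 1|²` for the scalar fine Laplacian (`ssym = n(ψ − 1)`). [folklore] -/
theorem re_lsym_eq_sum (p : Tor (fine n M)) :
    (lsym (fine n M) (n : ℂ) p).re = ∑ ν, (n : ℝ) ^ 2 * ‖((ZMod.stdAddChar (N := fine n M ν)) (p ν) : ℂ) - 1‖ ^ 2 := by
  unfold lsym
  rw [Complex.re_sum]
  refine Finset.sum_congr rfl fun ν _ => ?_
  rw [← Complex.normSq_eq_conj_mul_self, Complex.ofReal_re, Complex.normSq_eq_norm_sq]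
  unfold ssym
  rw [norm_mul, mul_pow, Complex.norm_natCast]

/-- `Δ(p) + 1 = ((Re Δ(p) + 1 : ℝ) : ℂ)` and `Re Δ(p) ≥ 0`. [folklore] -/
theorem lsym_add_one_eq_ofReal (p : Tor (fine n M)) :
    lsym (fine n M) (n : ℂ) p + 1 = (((lsym (fine n M) (n : ℂ) p).re + 1 : ℝ) : ℂ) := by
  have h := lsym_im_re (fine n M) (n : ℂ) p
  apply Complex.ext
  · simp
  · simp [h.1]

/-- **THE SYMBOL INEQUALITY** (no AM–GM: every factor is at most the sum): for `k ≥ d + 1`,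
`|(Δ(p) + 1)^{−k}| ≤ Π_ν (n²|ψ(p_ν) − 1|² + 1)⁻¹`. [folklore] -/
theorem norm_inv_lsym_add_one_pow_le_prod {k : ℕ} (hk : d + 1 ≤ k) (p : Tor (fine n M)) :
    ‖((lsym (fine n M) (n : ℂ) p + 1)⁻¹) ^ k‖
      ≤ ∏ ν, ((n : ℝ) ^ 2 * ‖((ZMod.stdAddChar (N := fine n M ν)) (p ν) : ℂ) - 1‖ ^ 2 + 1)⁻¹ := by
  set L := (lsym (fine n M) (n : ℂ) p).re with hL
  set ℓ : Fin (d + 1) → ℝ := fun ν => (n : ℝ) ^ 2 * ‖((ZMod.stdAddChar (N := fine n M ν)) (p ν) : ℂ) - 1‖ ^ 2 with hℓ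
  have hℓ0 : ∀ ν, 0 ≤ ℓ ν := fun ν => by rw [hℓ]; positivity
  have hLsum : L = ∑ ν, ℓ ν := by rw [hL, re_lsym_eq_sum]
  have hL0 : 0 ≤ L := by rw [hLsum]; exact Finset.sum_nonneg fun ν _ => hℓ0 ν
  have hL1 : 1 ≤ L + 1 := by linarith
  -- the norm as a real power
  have hnorm : ‖((lsym (fine n M) (n : ℂ) p + 1)⁻¹) ^ k‖ = ((L + 1) ^ k)⁻¹ := by
    rw [norm_pow, norm_inv, lsym_add_one_eq_ofReal, Complex.norm_real, Real.norm_of_nonneg (by linarith), ← hL, inv_pow]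
  rw [hnorm]
  -- each factor `ℓ ν + 1 ≤ L + 1`, hence `Π_ν (ℓ ν + 1) ≤ (L+1)^{d+1} ≤ (L+1)^k`
  have hfac : ∀ ν, ℓ ν + 1 ≤ L + 1 := fun ν => by
    rw [hLsum]
    linarith [Finset.single_le_sum (f := ℓ) (fun μ _ => hℓ0 μ) (Finset.mem_univ ν)]
  have hprod : ∏ ν, (ℓ ν + 1) ≤ (L + 1) ^ k := by
    calc ∏ ν, (ℓ ν + 1) ≤ ∏ _ν : Fin (d + 1), (L + 1) :=
          Finset.prod_le_prod (fun ν _ => by linarith [hℓ0 ν]) fun ν _ => hfac ν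
      _ = (L + 1) ^ (d + 1) := by rw [Finset.prod_const, Finset.card_univ, Fintype.card_fin]
      _ ≤ (L + 1) ^ k := pow_le_pow_right₀ hL1 hk
  have hprod0 : 0 < ∏ ν, (ℓ ν + 1) := Finset.prod_pos fun ν _ => by linarith [hℓ0 ν]
  calc ((L + 1) ^ k)⁻¹ ≤ (∏ ν, (ℓ ν + 1))⁻¹ := inv_anti₀ hprod0 hprod
    _ = ∏ ν, (ℓ ν + 1)⁻¹ := by rw [Finset.prod_inv_distrib]

/-- `|T_η| = Π_ν (n·M_ν)`. [folklore] -/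
theorem card_Tor_fine : (Fintype.card (Tor (fine n M)) : ℝ) = ∏ ν, ((n * M ν : ℕ) : ℝ) := by
  rw [Fintype.card_pi, Nat.cast_prod]
  exact Finset.prod_congr rfl fun ν _ => by rw [ZMod.card]

/-- **THE DIAGONAL (ENTRY) BOUND**: for every `k ≥ d + 1`, every `x, x′` and every torus,
`‖((Δ + 1)⁻¹)^k (x, x′)‖ ≤ 3^{d+1}·(n^{d+1})⁻¹` (`|T|⁻¹Σ_p Π_ν(…)⁻¹ = Π_ν (nM_ν)⁻¹Σ_j(…)⁻¹ ≤ Π_ν (2 + M_ν)/(nM_ν) ≤ (3/n)^{d+1}`).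
[folklore] -/
theorem norm_inv_pow_apply_le {k : ℕ} (hk : d + 1 ≤ k) (x x' : Tor (fine n M)) :
    ‖(((LapS (fine n M) (n : ℂ) + 1)⁻¹) ^ k) x x'‖ ≤ 3 ^ (d + 1) * ((n : ℝ) ^ (d + 1))⁻¹ := by
  classical
  have hn : (0 : ℝ) < n := by exact_mod_cast Nat.pos_of_ne_zero (NeZero.ne n)
  rw [LapSOne_inv_pow_eq]
  refine (norm_sandwich_apply_le (fine n M) _ x x').trans ?_
  -- (1) symbol inequality, termwise
  have h1 : ∑ p : Tor (fine n M), ‖((lsym (fine n M) (n : ℂ) p + 1)⁻¹) ^ k‖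
      ≤ ∑ p : Tor (fine n M), ∏ ν, ((n : ℝ) ^ 2 * ‖((ZMod.stdAddChar (N := fine n M ν)) (p ν) : ℂ) - 1‖ ^ 2 + 1)⁻¹ :=
    Finset.sum_le_sum fun p _ => norm_inv_lsym_add_one_pow_le_prod n M hk p
  -- (2) the sum of products is the product of the one-coordinate sums
  have h2 : ∑ p : Tor (fine n M), ∏ ν, ((n : ℝ) ^ 2 * ‖((ZMod.stdAddChar (N := fine n M ν)) (p ν) : ℂ) - 1‖ ^ 2 + 1)⁻¹
      = ∏ ν, ∑ j : ZMod (fine n M ν), ((n : ℝ) ^ 2 * ‖((ZMod.stdAddChar (N := fine n M ν)) j : ℂ) - 1‖ ^ 2 + 1)⁻¹ :=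
    (Fintype.prod_sum (fun ν (j : ZMod (fine n M ν)) =>
      ((n : ℝ) ^ 2 * ‖((ZMod.stdAddChar (N := fine n M ν)) j : ℂ) - 1‖ ^ 2 + 1)⁻¹)).symm
  -- (3) one coordinate: `Σ_j ≤ 2 + M_ν ≤ 3 M_ν`
  have h3 : ∀ ν, ∑ j : ZMod (fine n M ν), ((n : ℝ) ^ 2 * ‖((ZMod.stdAddChar (N := fine n M ν)) j : ℂ) - 1‖ ^ 2 + 1)⁻¹
      ≤ 3 * (M ν : ℝ) := by
    intro ν
    have hMν : (1 : ℝ) ≤ M ν := by exact_mod_cast Nat.one_le_iff_ne_zero.mpr (NeZero.ne (M ν))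
    have h := oneDim_sum_le n (M ν)
    exact h.trans (by linarith)
  have hcard : (Fintype.card (Tor (fine n M)) : ℝ)⁻¹ = ∏ ν, (((n * M ν : ℕ) : ℝ))⁻¹ := by
    rw [card_Tor_fine, Finset.prod_inv_distrib]
  rw [hcard]
  calc (∏ ν, (((n * M ν : ℕ) : ℝ))⁻¹) * ∑ p : Tor (fine n M), ‖((lsym (fine n M) (n : ℂ) p + 1)⁻¹) ^ k‖
      ≤ (∏ ν, (((n * M ν : ℕ) : ℝ))⁻¹) * ∏ ν, ∑ j : ZMod (fine n M ν),
          ((n : ℝ) ^ 2 * ‖((ZMod.stdAddChar (N := fine n M ν)) j : ℂ) - 1‖ ^ 2 + 1)⁻¹ := by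
        rw [← h2]
        exact mul_le_mul_of_nonneg_left h1 (Finset.prod_nonneg fun ν _ => by positivity)
    _ = ∏ ν, ((((n * M ν : ℕ) : ℝ))⁻¹ * ∑ j : ZMod (fine n M ν),
          ((n : ℝ) ^ 2 * ‖((ZMod.stdAddChar (N := fine n M ν)) j : ℂ) - 1‖ ^ 2 + 1)⁻¹) := by
        rw [← Finset.prod_mul_distrib]
    _ ≤ ∏ _ν : Fin (d + 1), (3 / (n : ℝ)) := by
        refine Finset.prod_le_prod (fun ν _ => mul_nonneg (by positivity) (Finset.sum_nonneg fun j _ => by positivity)) fun ν _ => ?_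
        have hMν : (0 : ℝ) < M ν := by exact_mod_cast Nat.pos_of_ne_zero (NeZero.ne (M ν))
        calc (((n * M ν : ℕ) : ℝ))⁻¹ * ∑ j : ZMod (fine n M ν), ((n : ℝ) ^ 2 * ‖((ZMod.stdAddChar (N := fine n M ν)) j : ℂ) - 1‖ ^ 2 + 1)⁻¹
            ≤ (((n * M ν : ℕ) : ℝ))⁻¹ * (3 * (M ν : ℝ)) := mul_le_mul_of_nonneg_left (h3 ν) (by positivity)
          _ = 3 / (n : ℝ) := by push_cast; field_simp
    _ = 3 ^ (d + 1) * ((n : ℝ) ^ (d + 1))⁻¹ := by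
        rw [Finset.prod_const, Finset.card_univ, Fintype.card_fin, div_pow, div_eq_mul_inv]

end Diagonal

end Summit.QuantumFields.BalabanUV.Beta.GAN24.ScalarFreeResolventDiagonal

end
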